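import Summits.BirchSwinnertonDyer.BirchSwinnertonDyer.Theorems.TameQuarticManinParityModThreeFrobeniusTwins
import Literature.NumberTheory.GaloisRepresentations.GL2F3Lift
import HarnessLib

/-!
# Route `TameQuarticManinParity`, stub B30 `IrrModThreeSplitTraceWitness` (stmt-BirchSwinnertonDyer-23598):
# an irreducible `ρ̄_{W,3}` has a Frobenius at `p ≡ 1 (mod N_W)`, `p ≠ 3`, with `a_p(W) ≢ 2 (mod 3)`

Lead seat `cruxlead-stmt-BirchSwinnertonDyer-23367` g0, line `abelian-fixed-points` (= LINE 29/30 of the pen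
bsd-idea-3 g9), registered stub `stub_traceWitness` of the crux MS (stmt-23367). THEOREMS ONLY: no definition, no
named fact, no `sorry`. Inputs, all PROVED in the tree: the framed mod-`3` representation of `W`
(`exists_isTorsionGaloisRep`), its Frobenius characteristic polynomials `X² − a_p X + p`
(`IsTorsionGaloisRep.charpoly_eq_of_isArithFrobAt` with `trace_/det_galoisRepTate_frobenius_of_hasGoodReductionAt_holds`),
the mod-`N` cyclotomic character with its values at Frobenius and complex conjugation
(`ModNCyclotomicCharacter`), Chebotarev in the form `exists_isArithFrobAt_mul_inv_mem_not_mem`, and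
`p`-group / Lagrange bookkeeping in `GL₂(𝔽₃)` (Mathlib).

## Proof (Serre 1972 §2 style; the pen's docstring of stmt-23598)

Put `M = 3N_W`, `K = ker χ_M ⊴ Γ_ℚ` (so `Γ_ℚ/K` is abelian). By Chebotarev every `g ∈ Γ_ℚ` has a Frobenius
twin `φ` at a prime `p ∤ 3N_W` with `ρ̄(φ) = ρ̄(g)`, `χ_M(φ) = χ_M(g)`, and `charpoly ρ̄(g) = X² − ā_p X + p̄`,
`χ_M(g) = p̄`. If the conclusion failed, every `g ∈ K` would have `p ≡ 1 (mod 3N)` and `a_p ≡ 2`, i.e.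
`charpoly ρ̄(g) = (X − 1)²`, so `U = ρ̄(K)` consists of unipotents: a `3`-subgroup of `GL₂(𝔽₃)` (order `48`), hence
of order `≤ 3`, cyclic. If `U ≠ 1`, the fixed line of a generator is `Γ_ℚ`-stable (`K` is normal); if `U = 1`,
`ρ̄(Γ_ℚ)` is abelian and commutes with `ρ̄(c)`, `c` complex conjugation, an involution of determinant
`χ_3(c) = −1`, whose `+1`-eigenline is then `Γ_ℚ`-stable. Either way `E[3]` has a `Γ_ℚ`-stable subgroup of
order `3`, contradicting irreducibility.
-/

set_option autoImplicit false
-- D-0017: single-problem summit, so `Summit.BirchSwinnertonDyer.BirchSwinnertonDyer.…` repeats a namespace BY DESIGN.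
set_option linter.dupNamespace false

noncomputable section

open scoped NumberField Polynomial
open Polynomial IsDedekindDomain NumberField Field
open Literature.NumberTheory.GaloisRepresentations Rat.HeightOneSpectrum

namespace Summit.BirchSwinnertonDyer.BirchSwinnertonDyer.Theorems.TameQuarticManinParity

open Summit.BirchSwinnertonDyer.BirchSwinnertonDyer.Theses.TameQuarticManinParity

/-! ### The stub -/

/-- **B30 `IrrModThreeSplitTraceWitness` (stmt-BirchSwinnertonDyer-23598), registered stub `stub_traceWitness` of
the crux MS (stmt-23367)**: if `ρ̄_{W,3}` is irreducible there is a prime `p ≠ 3`, `p ≡ 1 (mod N_W)`, with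
`a_p(W) ≢ 2 (mod 3)`. Proof: see the module docstring (Chebotarev transport of Frobenius characteristic polynomials
and of the cyclotomic character; a `3`-subgroup of `GL₂(𝔽₃)` is cyclic of order `≤ 3`; complex conjugation is an
involution of determinant `−1`; Boston–Lenstra–Ribet-free). [cite: Serre1972, §2] -/
theorem stub_traceWitness : IrrModThreeSplitTraceWitness := by
  intro W _ _ _ hirr
  classical
  haveI : Fact (Nat.Prime 3) := ⟨Nat.prime_three⟩
  haveI : NeZero ((3 : ℕ) : ℚ) := ⟨by norm_num⟩
  obtain ⟨ρ, hρ⟩ := WeierstrassCurve.exists_isTorsionGaloisRep W 3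
  -- modulus `M = 3 N_W`
  haveI hM0 : NeZero (3 * W.conductorNorm ℤ) := ⟨mul_ne_zero three_ne_zero (NeZero.ne _)⟩
  haveI : NeZero ((3 * W.conductorNorm ℤ : ℕ) : ℚ) := ⟨by exact_mod_cast hM0.ne⟩
  set χ := modNCyclotomicCharacter ℚ (3 * W.conductorNorm ℤ) with hχdef
  by_contra hneg
  push Not at hneg
  -- (A) every `g ∈ ker χ` is unipotent under `ρ̄`
  have hA : ∀ g : absoluteGaloisGroup ℚ, χ g = 1 →
      ((ρ g : GL (Fin 2) (ZMod 3)) : Matrix (Fin 2) (Fin 2) (ZMod 3)).charpoly =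
        X ^ 2 - C (2 : ZMod 3) * X + C (1 : ZMod 3) := by
    intro g hg
    obtain ⟨p, hpp, hp3, -, -, hχg, hch⟩ := exists_prime_frobTwin W (3 * W.conductorNorm ℤ) hρ g
    have h1 : (p : ZMod (3 * W.conductorNorm ℤ)) = ((1 : ℕ) : ZMod (3 * W.conductorNorm ℤ)) := by
      rw [← hχg, ← hχdef, hg, Units.val_one, Nat.cast_one]
    have hmod : p ≡ 1 [MOD 3 * W.conductorNorm ℤ] := (ZMod.natCast_eq_natCast_iff _ _ _).mp h1
    have hmodN : p ≡ 1 [MOD W.conductorNorm ℤ] := hmod.of_mul_left 3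
    have hmod3 : p ≡ 1 [MOD 3] := hmod.of_mul_right (W.conductorNorm ℤ)
    have hap : ((W.LFunction p : ℤ) : ZMod 3) = 2 := by
      have hd := hneg p hpp hp3 hmodN
      have : ((2 : ℤ) : ZMod 3) = ((W.LFunction p : ℤ) : ZMod 3) :=
        (ZMod.intCast_eq_intCast_iff_dvd_sub _ _ _).mpr hd
      rw [← this]
      norm_num
    have hp1 : ((p : ℕ) : ZMod 3) = 1 := by
      have := (ZMod.natCast_eq_natCast_iff _ _ _).mpr hmod3
      rwa [Nat.cast_one] at this
    rw [hch, hap, hp1]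
  -- the subgroup `U = ρ̄(ker χ)` of `GL₂(𝔽₃)` and its order
  set ρ₀ : absoluteGaloisGroup ℚ →* GL (Fin 2) (ZMod 3) := ρ.toMonoidHom with hρ₀
  set U : Subgroup (GL (Fin 2) (ZMod 3)) := (χ.ker).map ρ₀ with hUdef
  have hUmem : ∀ u ∈ U, ∃ g, χ g = 1 ∧ ρ g = u := by
    intro u hu
    obtain ⟨g, hg, rfl⟩ := Subgroup.mem_map.mp hu
    exact ⟨g, (MonoidHom.mem_ker).mp hg, rfl⟩
  have hU3 : ∀ u ∈ U, u ^ 3 = 1 := by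
    intro u hu
    obtain ⟨g, hg, rfl⟩ := hUmem u hu
    apply Units.ext
    rw [Units.val_pow_eq_pow_val, Units.val_one]
    exact (sub_one_sq_eq_zero_of_charpoly (hA g hg)).2
  have hPU : IsPGroup 3 U := fun u ↦ ⟨1, Subtype.ext (by
    rw [pow_one, SubmonoidClass.coe_pow, OneMemClass.coe_one]
    exact hU3 u u.2)⟩
  obtain ⟨k, hk⟩ := (IsPGroup.iff_card).mp hPU
  have hdvd : Nat.card U ∣ 48 := by
    rw [← Literature.NumberTheory.GaloisRepresentations.GL2F3Lift.card_GL_fin_two_zmod_three]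
    exact Subgroup.card_subgroup_dvd_card U
  have hk1 : k ≤ 1 := by
    by_contra hk2
    push Not at hk2
    have h9 : 3 ^ 2 ∣ 48 := (Nat.pow_dvd_pow 3 hk2).trans (hk ▸ hdvd)
    revert h9
    decide
  -- the frame `e : E[3] ≃ 𝔽₃²` and the irreducibility contradiction from a stable line
  obtain ⟨e, he⟩ := hρ
  have hline : ∀ L : Submodule (ZMod 3) (Fin 2 → ZMod 3), L ≠ ⊥ → L ≠ ⊤ →
      (∀ (γ : absoluteGaloisGroup ℚ) (x : Fin 2 → ZMod 3), x ∈ L →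
        ((ρ γ : GL (Fin 2) (ZMod 3)) : Matrix (Fin 2) (Fin 2) (ZMod 3)).mulVec x ∈ L) → False := by
    intro L hLbot hLtop hstab
    set H : AddSubgroup (WeierstrassCurve.geomTorsion W 3) := L.toAddSubgroup.comap e.toAddMonoidHom with hHdef
    have hHmem : ∀ P, P ∈ H ↔ e P ∈ L := fun P ↦ Iff.rfl
    have hH : ∀ σ : absoluteGaloisGroup ℚ, ∀ P ∈ H, σ • P ∈ H := by
      intro σ P hP
      rw [hHmem] at hP ⊢
      rw [he]
      exact hstab σ _ hP
    rcases hirr H hH with hbot | htop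
    · apply hLbot
      rw [eq_bot_iff]
      intro x hx
      have hx' : e.symm x ∈ H := by
        rw [hHmem, AddEquiv.apply_symm_apply]
        exact hx
      rw [hbot, AddSubgroup.mem_bot] at hx'
      rw [Submodule.mem_bot, ← e.apply_symm_apply x, hx', map_zero]
    · apply hLtop
      rw [eq_top_iff]
      intro x _
      have hx' : e.symm x ∈ H := by rw [htop]; exact AddSubgroup.mem_top _
      rw [hHmem, AddEquiv.apply_symm_apply] at hx'
      exact hx'
  -- `χ` is a class function: conjugates of elements of `ker χ` lie in `ker χ`
  have hχconj : ∀ γ g : absoluteGaloisGroup ℚ, χ g = 1 → χ (γ⁻¹ * g * γ) = 1 := by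
    intro γ g hg
    rw [map_mul, map_mul, hg, mul_one, map_inv, inv_mul_cancel]
  by_cases hcase : ∃ g : absoluteGaloisGroup ℚ, χ g = 1 ∧ ρ g ≠ 1
  · -- Case 1: `U ≠ 1` is cyclic of order `3`; the fixed line of a generator is `Γ`-stable
    obtain ⟨g₀, hg₀, hu₀⟩ := hcase
    set u₀ : GL (Fin 2) (ZMod 3) := ρ g₀ with hu₀def
    have hu₀U : u₀ ∈ U := Subgroup.mem_map.mpr ⟨g₀, (MonoidHom.mem_ker).mpr hg₀, rfl⟩
    have hunip := (sub_one_sq_eq_zero_of_charpoly (hA g₀ hg₀)).1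
    have hu₀ne : ((u₀ : GL (Fin 2) (ZMod 3)) : Matrix (Fin 2) (Fin 2) (ZMod 3)) ≠ 1 := fun h ↦
      hu₀ (Units.ext h)
    -- `U = ⟨u₀⟩`
    have hord : orderOf (⟨u₀, hu₀U⟩ : U) = 3 := by
      refine orderOf_eq_prime ?_ ?_
      · exact Subtype.ext (by rw [SubmonoidClass.coe_pow, OneMemClass.coe_one]; exact hU3 u₀ hu₀U)
      · intro h
        exact hu₀ (congrArg Subtype.val h)
    have hcardU : Nat.card U = 3 := by
      have hle : 3 ≤ Nat.card U := by
        have h := Subgroup.card_subgroup_dvd_card (Subgroup.zpowers (⟨u₀, hu₀U⟩ : U))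
        rw [Nat.card_zpowers, hord] at h
        exact Nat.le_of_dvd (Nat.card_pos) h
      interval_cases k
      · rw [hk] at hle; norm_num at hle
      · rw [hk]; norm_num
    have hzp : Subgroup.zpowers (⟨u₀, hu₀U⟩ : U) = ⊤ := by
      refine Subgroup.eq_top_of_card_eq _ ?_
      rw [Nat.card_zpowers, hord, hcardU]
    have hpow : ∀ u ∈ U, ∃ i : ℤ, u₀ ^ i = u := by
      intro u hu
      have hmem : (⟨u, hu⟩ : U) ∈ Subgroup.zpowers (⟨u₀, hu₀U⟩ : U) := by rw [hzp]; exact Subgroup.mem_top _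
      obtain ⟨i, hi⟩ := Subgroup.mem_zpowers_iff.mp hmem
      exact ⟨i, by simpa using congrArg Subtype.val hi⟩
    set L := LinearMap.ker (Matrix.toLin' (((u₀ : GL (Fin 2) (ZMod 3)) : Matrix (Fin 2) (Fin 2) (ZMod 3)) - 1))
      with hLdef
    obtain ⟨hLbot, hLtop⟩ := ker_sub_one_ne_of_unipotent hunip hu₀ne
    refine hline L hLbot hLtop fun γ x hx ↦ ?_
    -- `x` is fixed by `u₀`, hence by all of `U = ⟨u₀⟩`, in particular by `ρ(γ⁻¹ g₀ γ)`
    have hfix : ((u₀ : GL (Fin 2) (ZMod 3)) : Matrix (Fin 2) (Fin 2) (ZMod 3)).mulVec x = x := by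
      rw [hLdef, LinearMap.mem_ker, Matrix.toLin'_apply, Matrix.sub_mulVec, Matrix.one_mulVec, sub_eq_zero] at hx
      exact hx
    -- the stabiliser of `x` in `GL₂(𝔽₃)` (acting by `mulVec`) contains `u₀`, hence `U = ⟨u₀⟩`
    let S : Subgroup (GL (Fin 2) (ZMod 3)) :=
      { carrier := {u | ((u : GL (Fin 2) (ZMod 3)) : Matrix (Fin 2) (Fin 2) (ZMod 3)).mulVec x = x}
        one_mem' := by simp only [Set.mem_setOf_eq, Units.val_one, Matrix.one_mulVec]
        mul_mem' := fun {u v} hu hv ↦ by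
          simp only [Set.mem_setOf_eq] at hu hv ⊢
          rw [Units.val_mul, ← Matrix.mulVec_mulVec, hv, hu]
        inv_mem' := fun {u} hu ↦ by
          simp only [Set.mem_setOf_eq] at hu ⊢
          conv_lhs => rw [← hu]
          rw [Matrix.mulVec_mulVec, ← Units.val_mul, inv_mul_cancel, Units.val_one, Matrix.one_mulVec] }
    have hu₀S : u₀ ∈ S := hfix
    have hstabU : U ≤ S := by
      intro u hu
      obtain ⟨i, rfl⟩ := hpow u hu
      exact Subgroup.zpow_mem _ hu₀S i
    have hg' : ρ (γ⁻¹ * g₀ * γ) ∈ U :=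
      Subgroup.mem_map.mpr ⟨γ⁻¹ * g₀ * γ, (MonoidHom.mem_ker).mpr (hχconj γ g₀ hg₀), rfl⟩
    have hfix' : ((ρ (γ⁻¹ * g₀ * γ) : GL (Fin 2) (ZMod 3)) : Matrix (Fin 2) (Fin 2) (ZMod 3)).mulVec x = x :=
      hstabU hg'
    rw [hLdef, LinearMap.mem_ker, Matrix.toLin'_apply, Matrix.sub_mulVec, Matrix.one_mulVec, sub_eq_zero,
      Matrix.mulVec_mulVec]
    -- `u₀ ρ(γ) = ρ(γ) ρ(γ⁻¹ g₀ γ)`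
    have hcomm : ((u₀ : GL (Fin 2) (ZMod 3)) : Matrix (Fin 2) (Fin 2) (ZMod 3)) *
        ((ρ γ : GL (Fin 2) (ZMod 3)) : Matrix (Fin 2) (Fin 2) (ZMod 3)) =
        ((ρ γ : GL (Fin 2) (ZMod 3)) : Matrix (Fin 2) (Fin 2) (ZMod 3)) *
          ((ρ (γ⁻¹ * g₀ * γ) : GL (Fin 2) (ZMod 3)) : Matrix (Fin 2) (Fin 2) (ZMod 3)) := by
      rw [← Units.val_mul, ← Units.val_mul, hu₀def, ← map_mul, ← map_mul]
      congr 2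
      group
    rw [hcomm, ← Matrix.mulVec_mulVec, hfix']
  · -- Case 2: `ρ̄` is trivial on `ker χ`, so `ρ̄(Γ)` is abelian; use complex conjugation
    push Not at hcase
    have hcommρ : ∀ γ γ' : absoluteGaloisGroup ℚ,
        ((ρ γ : GL (Fin 2) (ZMod 3)) : Matrix (Fin 2) (Fin 2) (ZMod 3)) *
          ((ρ γ' : GL (Fin 2) (ZMod 3)) : Matrix (Fin 2) (Fin 2) (ZMod 3)) =
        ((ρ γ' : GL (Fin 2) (ZMod 3)) : Matrix (Fin 2) (Fin 2) (ZMod 3)) *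
          ((ρ γ : GL (Fin 2) (ZMod 3)) : Matrix (Fin 2) (Fin 2) (ZMod 3)) := by
      intro γ γ'
      have hk : χ (γ * γ' * γ⁻¹ * γ'⁻¹) = 1 := by
        rw [map_mul, map_mul, map_mul, map_inv, map_inv, mul_inv_cancel_comm, mul_inv_cancel]
      have h1 : ρ (γ * γ' * γ⁻¹ * γ'⁻¹) = 1 := hcase _ hk
      rw [map_mul, map_mul, map_mul, map_inv, map_inv, mul_inv_eq_one, mul_inv_eq_iff_eq_mul] at h1
      rw [← Units.val_mul, ← Units.val_mul, h1]
    obtain ⟨c, hc⟩ := exists_isComplexConjugation (Rat.castHom ℝ)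
    set u : Matrix (Fin 2) (Fin 2) (ZMod 3) := ((ρ c : GL (Fin 2) (ZMod 3)) : Matrix (Fin 2) (Fin 2) (ZMod 3))
      with hudef
    have huu : u * u = 1 := by
      rw [hudef, ← Units.val_mul, ← map_mul, ← sq, hc.sq_eq_one, map_one, Units.val_one]
    -- `det ρ̄(c) = χ₃(c) = −1` by transport
    have hdet : u.det = -1 := by
      obtain ⟨p, hpp, hp3, -, -, hχc, hch⟩ := exists_prime_frobTwin W (3 * W.conductorNorm ℤ) ⟨e, he⟩ c
      have hneg1 : (p : ZMod (3 * W.conductorNorm ℤ)) = -1 := by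
        rw [← hχc, modNCyclotomicCharacter_of_isComplexConjugation hc]
      have h3d : 3 ∣ 3 * W.conductorNorm ℤ := dvd_mul_right 3 _
      have hp3' : ((p : ℕ) : ZMod 3) = -1 := by
        have := congrArg (ZMod.castHom h3d (ZMod 3)) hneg1
        rwa [map_natCast, map_neg, map_one] at this
      rw [hudef, det_eq_of_charpoly_eq hch, hp3']
    obtain ⟨hLbot, hLtop⟩ := ker_sub_one_ne_of_involution huu hdet
    refine hline _ hLbot hLtop fun γ x hx ↦ ?_
    rw [LinearMap.mem_ker, Matrix.toLin'_apply] at hx ⊢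
    rw [Matrix.mulVec_mulVec, sub_mul, one_mul, hudef, hcommρ c γ, ← hudef,
      show ((ρ γ : GL (Fin 2) (ZMod 3)) : Matrix (Fin 2) (Fin 2) (ZMod 3)) * u -
        ((ρ γ : GL (Fin 2) (ZMod 3)) : Matrix (Fin 2) (Fin 2) (ZMod 3)) =
        ((ρ γ : GL (Fin 2) (ZMod 3)) : Matrix (Fin 2) (Fin 2) (ZMod 3)) * (u - 1) by noncomm_ring,
      ← Matrix.mulVec_mulVec, hx, Matrix.mulVec_zero]


end Summit.BirchSwinnertonDyer.BirchSwinnertonDyer.Theorems.TameQuarticManinParity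

end
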